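import Summits.BirchSwinnertonDyer.BirchSwinnertonDyer.Theorems.ManinLocalTwoThreeEtaIdentityFifteen
import Summits.BirchSwinnertonDyer.BirchSwinnertonDyer.Theorems.ManinLocalTwoThreeAnalyticBridge
import Summits.BirchSwinnertonDyer.BirchSwinnertonDyer.Theorems.ManinLocalTwoThreeNeronSqueeze
import Literature.NumberTheory.EllipticCurves.Rank1Residual.X11RankOneCertificates.Minimality
import HarnessLib

/-!
# Level 15 COMPLETE, fact-free: `|c| = 1` for every lattice-optimal `X₀(15)`-datum — a new ROOT for the twist families

Cell bsd-f2-manin, route `ManinLocalTwoThree` (cruxes C2 `ManinOddAtFour` stmt-22967 / C3 `ManinPrimeToThreeAtNine` stmt-22968),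
prover seat p3 gen 25; sequel to `…EtaQuotientsFifteen` / `…EtaIdentityFifteen`; the level-`15` twin of `…ManinConstantFourteen`.
`X₀(15)` is the elliptic curve `15a1`; the level is semistable, so this is not a point of the C2/C3 domains but a ROOT: with
`LevelManinOne 15` (this file's `abs_maninConstant_eq_one_fifteen`, verbatim that shape) the tree's fact-free twist engines
(`…TwistFamiliesFactFree`, `…DyadicTwistFamiliesFactFree`) yield `|c| = 1` — hence `2 ∤ c`, `3 ∤ c` — on the additive twist
images `240 = 16·15` (`15a ⊗ χ₋₄`), `960`, `1920`, `15p²` (`p ≥ 7`), … (sequel file).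

THE ARGUMENT.  §1 `D.f = f₁₅ = η₁η₃η₅η₁₅` for EVERY `X₀(15)`-datum (`S₂(Γ₀(15)) = ℂf₁₅` is the tree's
`cuspForm_two_eq_smul_eta_14_15_24`, and `a₁ = 1`).  §2 With `𝓔 = x + 1 = η₃η₅⁵/(η₁η₁₅⁵)` and `X = 𝓔 − 7/12` (`= x + b₂/12`),
`𝓔′ = (πi/12)G𝓔` and the weight-4 identity `G²𝓔 = 576f₁₅²(4𝓔² − 7𝓔 − 36)` (`EtaIdentityFifteen.G_sq_mul_E_eq`) give the
Weierstrass differential equation `(X′)² = (2πif₁₅)²(4X³ − g₂X − g₃)` with `(g₂, g₃) = (c₄/12, c₆/216) = (481/12, 4879/216)`, the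
invariants of `15a1 = [1, 1, 1, −10, −10]` (`c₄ = 481`, `c₆ = 4879`, `Δ = 50625 = 3⁴5⁴`); `X` is holomorphic and `Γ₀(15)`-invariant
and the cubic is not identically zero (`𝓔q² → 1`), so the analytic bridge `AnalyticBridge.periodLattice_le_of_deriv_sq` puts
every period of `f₁₅` in the lattice `Λ(481/12, 4879/216)` — (S2)₁₅.  §3 That lattice is the Néron lattice of the globally
minimal `W₀ = [1, 1, 1, −10, −10]`, so the NÉRON SQUEEZE `NeronSqueeze.abs_maninConstant_eq_one_of_periodLattice_le` gives
`|D.maninConstant| = 1` for every globally minimal `W` and every `X₀(15)`-datum `D` with the lattice clause.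

HONEST FRAMING: unconditional (standard axioms), no modularity, no CDT, no printed Manin fact, no Cremona table; ONE MORE complete
level, a semistable one; nothing here proves C2, C3 (∀ N), Manin's conjecture or BSD; items 22967/22968 stay OPEN.  No
definition, no named fact, no sorry. [cite: CremonaAlgorithms1997, §2.10 and Table 1 (15a1)] [cite: Manin1972, Prop. 1.4]
[cite: SilvermanAEC2009, VII.1 Remark 1.1] [cite: AgasheRibetStein2006, §§1–2]
-/

set_option autoImplicit false
-- lint-debt: the directory name repeats the summit name (sibling precedent `ManinLocalTwoThreeNeronSqueezeTwenty.lean`)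
set_option linter.dupNamespace false

noncomputable section

open Complex Filter Topology Set Function Asymptotics
open UpperHalfPlane hiding I
open scoped Real Topology Manifold MatrixGroups ModularForm
open ModularForm CongruenceSubgroup
open Literature.NumberTheory.ModularForms
open Literature.NumberTheory.EllipticCurves Literature.NumberTheory.EllipticCurves.ModularForms
open Summit.BirchSwinnertonDyer.BirchSwinnertonDyer.Theorems.ManinLocalTwoThree

namespace Summit.BirchSwinnertonDyer.BirchSwinnertonDyer.Theorems.ManinLocalTwoThree.LevelFifteen

open AnalyticBridge EtaQuotientsFifteen EtaIdentityFifteen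

/-! ## §1 `D.f = f₁₅` for every `X₀(15)`-datum (FACT-FREE) -/

/-- `⇑f₁₅ = etaQuotient 15 [(1,1),(3,1),(5,1),(15,1)]` (unfolding the tree's `cuspFormEta15`). [folklore] -/
theorem coe_cuspFormEta15 : (cuspFormEta15 : ℍ → ℂ) = etaQuotient 15 (expFn [(1, 1), (3, 1), (5, 1), (15, 1)]) := rfl

/-- **`f₁₅(τ)/q → 1` at `i∞`** (order `(1 + 3 + 5 + 15)/24 = 1`, leading coefficient `1`). [cite: Koehler2011, §1] -/
theorem tendsto_cuspFormEta15_div_qParam :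
    Tendsto (fun τ : ℍ ↦ cuspFormEta15 τ / Function.Periodic.qParam 1 (τ : ℂ)) atImInfty (𝓝 1) := by
  have h := tendsto_etaQuotient_div_qParam_zpow 15 (expFn [(1, 1), (3, 1), (5, 1), (15, 1)]) 1 (by decide)
  refine h.congr fun τ ↦ ?_
  rw [zpow_one, coe_cuspFormEta15]

/-- **`a₁(f₁₅) = 1`.** [cite: CremonaAlgorithms1997, Table 3 (N = 15)] -/
theorem cuspCoeff_one_cuspFormEta15 : cuspCoeff cuspFormEta15 1 = 1 :=
  NonVacuityTwentySeven.cuspCoeff_one_eq_of_tendsto _ tendsto_cuspFormEta15_div_qParam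

/-- `f₁₅ ≠ 0`. [folklore] -/
theorem cuspFormEta15_ne_zero : cuspFormEta15 ≠ 0 := by
  intro h
  have := congrArg (fun f : CuspForm (Gamma0 15) 2 ↦ f UpperHalfPlane.I) h
  simp only [CuspForm.zero_apply] at this
  exact etaQuotient_ne_zero 15 _ UpperHalfPlane.I (by rw [← coe_cuspFormEta15]; exact this)

/-- **Every normalised weight-`2` newform on `Γ₀(15)` is `f₁₅`** (`S₂(Γ₀(15)) = ℂf₁₅`, tree `cuspForm_two_eq_smul_eta_14_15_24`).
[cite: DiamondShurman2005, Thm. 3.5.1] -/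
theorem eq_cuspFormEta15_of_isNewform0 {g : CuspForm (Gamma0 15) 2} (hg : IsNewform0 g) : g = cuspFormEta15 := by
  obtain ⟨c, hc⟩ := cuspForm_two_eq_smul_eta_14_15_24.2.1 g
  have h1 : cuspCoeff g 1 = 1 := hg.2.2
  have hc1 : c = 1 := by
    have h := congrArg (cuspCoeff · 1) hc
    simp only [cuspCoeff_smul, h1, cuspCoeff_one_cuspFormEta15, mul_one] at h
    exact h
  rw [← hc, hc1, one_smul]

/-- **Every `X₀(15)`-datum of every curve has newform `f₁₅ = η₁η₃η₅η₁₅`** — FACT-FREE. [cite: CremonaAlgorithms1997, Table 3 (N = 15)] -/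
theorem f_eq_cuspFormEta15 {W : WeierstrassCurve ℚ} (D : ModularParametrizationData W 15) : D.f = cuspFormEta15 :=
  eq_cuspFormEta15_of_isNewform0 D.isNewformOf.1

/-! ## §2 The differential equation and (S2)₁₅: `Λ(f₁₅) ⊆ Λ(481/12, 4879/216)` -/

/-- **`(X′)² = (2πif₁₅)²(4X³ − g₂X − g₃)` on `ℍ`** for `X = 𝓔 − 7/12`, `(g₂, g₃) = (481/12, 4879/216)`:
`4X³ − (481/12)X − 4879/216 = 𝓔(4𝓔² − 7𝓔 − 36)` and `(𝓔′)² = (πi/12)²G²𝓔² = −4π²f₁₅²·𝓔(4𝓔² − 7𝓔 − 36)`.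
[cite: CremonaAlgorithms1997, §2.10] -/
theorem deriv_sq_fifteen (τ : ℍ) :
    deriv ((fun σ : ℍ ↦ etaQuotient 15 (expFn [(1, -1), (3, 1), (5, 5), (15, -5)]) σ + (-7 / 12)) ∘ ofComplex) τ ^ 2
      = (2 * π * Complex.I * cuspFormEta15 τ) ^ 2
        * (4 * (etaQuotient 15 (expFn [(1, -1), (3, 1), (5, 5), (15, -5)]) τ + (-7 / 12)) ^ 3
          - (481 / 12 : ℂ) * (etaQuotient 15 (expFn [(1, -1), (3, 1), (5, 5), (15, -5)]) τ + (-7 / 12)) - (4879 / 216 : ℂ)) := by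
  have hd : deriv ((fun σ : ℍ ↦ etaQuotient 15 (expFn [(1, -1), (3, 1), (5, 5), (15, -5)]) σ + (-7 / 12)) ∘ ofComplex) τ
      = deriv (etaQuotient 15 (expFn [(1, -1), (3, 1), (5, 5), (15, -5)]) ∘ ofComplex) τ := by
    rw [show ((fun σ : ℍ ↦ etaQuotient 15 (expFn [(1, -1), (3, 1), (5, 5), (15, -5)]) σ + (-7 / 12)) ∘ ofComplex)
      = fun z ↦ (etaQuotient 15 (expFn [(1, -1), (3, 1), (5, 5), (15, -5)]) ∘ ofComplex) z + (-7 / 12) from rfl, deriv_add_const]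
  rw [hd, deriv_E τ, show (cuspFormEta15 : ℍ → ℂ) τ = etaQuotient 15 (expFn [(1, 1), (3, 1), (5, 1), (15, 1)]) τ from
    congrFun coe_cuspFormEta15 τ]
  linear_combination (π * Complex.I / 12) ^ 2 * etaQuotient 15 (expFn [(1, -1), (3, 1), (5, 5), (15, -5)]) τ * G_sq_mul_E_eq τ

/-- `𝓔 · q² → 1` at `i∞` (`Σ δ r_δ = −48`). [folklore] -/
theorem tendsto_E_mul_qParam_sq :
    Tendsto (fun τ : ℍ ↦ etaQuotient 15 (expFn [(1, -1), (3, 1), (5, 5), (15, -5)]) τ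
      * Function.Periodic.qParam 1 (τ : ℂ) ^ (2 : ℤ)) atImInfty (𝓝 1) := by
  have h := tendsto_etaQuotient_div_qParam_zpow 15 (expFn [(1, -1), (3, 1), (5, 5), (15, -5)]) (-2) (by decide)
  refine h.congr fun τ ↦ ?_
  rw [zpow_neg, div_inv_eq_mul]

/-- Non-degeneracy: `4X³ − g₂X − g₃ = 𝓔(4𝓔² − 7𝓔 − 36) ≠ 0` somewhere (else, `𝓔` never vanishing, `‖𝓔‖ ≤ 6` everywhere,
contradicting `𝓔q² → 1`, `q → 0`). [folklore] -/
theorem exists_nondegenerate :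
    ∃ τ₀ : ℍ, 4 * (etaQuotient 15 (expFn [(1, -1), (3, 1), (5, 5), (15, -5)]) τ₀ + (-7 / 12)) ^ 3
      - (481 / 12 : ℂ) * (etaQuotient 15 (expFn [(1, -1), (3, 1), (5, 5), (15, -5)]) τ₀ + (-7 / 12))
      - (4879 / 216 : ℂ) ≠ 0 := by
  by_contra hne
  push Not at hne
  set x : ℍ → ℂ := etaQuotient 15 (expFn [(1, -1), (3, 1), (5, 5), (15, -5)]) with hx
  have hb : ∀ τ : ℍ, ‖x τ‖ ≤ 6 := by
    intro τ
    have hx0 : x τ ≠ 0 := etaQuotient_ne_zero 15 _ τ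
    have hcub : x τ * (4 * x τ ^ 2 - 7 * x τ - 36) = 0 := by linear_combination hne τ
    have hq : 4 * x τ ^ 2 - 7 * x τ - 36 = 0 := (mul_eq_zero.mp hcub).resolve_left hx0
    have h : x τ ^ 2 = 7 / 4 * x τ + 9 := by linear_combination (1 / 4 : ℂ) * hq
    have hn : ‖x τ‖ ^ 2 ≤ 7 / 4 * ‖x τ‖ + 9 := by
      rw [← norm_pow, h]
      refine (norm_add_le _ _).trans ?_
      rw [norm_mul]
      norm_num
    by_contra hlt
    push Not at hlt
    nlinarith [norm_nonneg (x τ), sq_nonneg (‖x τ‖ - 6)]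
  have h0 : Tendsto (fun τ : ℍ ↦ x τ * Function.Periodic.qParam 1 (τ : ℂ) ^ (2 : ℤ)) atImInfty (𝓝 0) := by
    have hq := tendsto_qParam_zpow_atImInfty (m := 2) (by norm_num)
    have hbd : IsBoundedUnder (· ≤ ·) atImInfty ((‖·‖) ∘ x) :=
      ⟨6, Filter.eventually_map.mpr (Filter.Eventually.of_forall hb)⟩
    have := hq.zero_mul_isBoundedUnder_le hbd
    exact this.congr fun τ ↦ mul_comm _ _
  exact one_ne_zero (tendsto_nhds_unique tendsto_E_mul_qParam_sq h0)

/-- **(S2)₁₅**: the period lattice of `f₁₅` lies in the lattice with invariants `g₂ = 481/12 = c₄(15a1)/12`,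
`g₃ = 4879/216 = c₆(15a1)/216` (analytic bridge with `X = 𝓔 − 7/12`). [cite: Manin1972, Prop. 1.4] [cite: CremonaAlgorithms1997, §2.10] -/
theorem periodLatticeLe_fifteen :
    ∃ L₁ : PeriodPair, L₁.g₂ = 481 / 12 ∧ L₁.g₃ = 4879 / 216 ∧
      ∀ z ∈ periodLattice cuspFormEta15, z ∈ L₁.lattice := by
  obtain ⟨L₁, hg2, hg3⟩ := PeriodPair.uniformization_holds (481 / 12) (4879 / 216) (by norm_num)
  refine ⟨L₁, hg2, hg3, periodLattice_le_of_deriv_sq cuspFormEta15 cuspFormEta15_ne_zero L₁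
    (fun τ ↦ etaQuotient 15 (expFn [(1, -1), (3, 1), (5, 5), (15, -5)]) τ + (-7 / 12))
    ((mdifferentiable_etaQuotient 15 _).add mdifferentiable_const)
    (fun γ τ ↦ by simp only [E_smul γ τ]) ?_ (by rw [hg2, hg3]; exact exists_nondegenerate)⟩
  intro τ
  rw [hg2, hg3]
  exact deriv_sq_fifteen τ

/-! ## §3 The Néron squeeze with `W₀ = [1, 1, 1, −10, −10] = 15a1` -/

/-- `Δ(W₀) = 50625 = 3⁴·5⁴` for `W₀ = [1, 1, 1, −10, −10]`. [cite: CremonaAlgorithms1997, Table 1 (15a1)] -/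
theorem Δ_W15 : (⟨1, 1, 1, -10, -10⟩ : WeierstrassCurve ℚ).Δ = 50625 := by
  norm_num [WeierstrassCurve.Δ, WeierstrassCurve.b₂, WeierstrassCurve.b₄, WeierstrassCurve.b₆, WeierstrassCurve.b₈]

/-- `W₀ = [1, 1, 1, −10, −10]` is an elliptic curve. [cite: CremonaAlgorithms1997, Table 1 (15a1)] -/
theorem isElliptic_W15 : (⟨1, 1, 1, -10, -10⟩ : WeierstrassCurve ℚ).IsElliptic := by
  rw [WeierstrassCurve.isElliptic_iff, Δ_W15]; norm_num

/-- `W₀ = [1, 1, 1, −10, −10]` is a global minimal model (`Δ = 3⁴·5⁴`: no prime `q` with `q¹² ∣ Δ`).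
[cite: SilvermanAEC2009, VII.1 Remark 1.1] -/
theorem isGloballyMinimal_W15 : (⟨1, 1, 1, -10, -10⟩ : WeierstrassCurve ℚ).IsGloballyMinimal := by
  have h := Rank1Residual.X11RankOneCertificates.isGloballyMinimal_of_int_criterion 1 1 1 (-10) (-10) ?_
  · simpa using h
  rintro q hq ⟨h12, -⟩
  rw [show Rank1Residual.X11RankOneCertificates.discOf [1, 1, 1, -10, -10] = 50625 by decide] at h12
  have h' : q ^ 12 ∣ 50625 := by
    have := Int.natAbs_dvd_natAbs.mpr h12
    simpa [Int.natAbs_pow] using this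
  have hle : q ^ 12 ≤ 50625 := Nat.le_of_dvd (by norm_num) h'
  have hq2 := hq.two_le
  have hq3 : q < 3 := by
    by_contra hge
    push Not at hge
    have := Nat.pow_le_pow_left hge 12
    norm_num at this
    omega
  interval_cases q
  norm_num at h'

/-- The lattice with invariants `(481/12, 4879/216)` is a Néron lattice of `W₀ = [1, 1, 1, −10, −10]` (`c₄ = 481`, `c₆ = 4879`).
[cite: CremonaAlgorithms1997, Table 1 (15a1)] -/
theorem isNeronLatticeOf_W15 {L₁ : PeriodPair} (hg2 : L₁.g₂ = 481 / 12) (hg3 : L₁.g₃ = 4879 / 216) :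
    IsNeronLatticeOf ((⟨1, 1, 1, -10, -10⟩ : WeierstrassCurve ℚ).baseChange ℂ) L₁ := by
  constructor
  · rw [hg2]
    norm_num [WeierstrassCurve.baseChange, WeierstrassCurve.map_c₄, WeierstrassCurve.c₄,
      WeierstrassCurve.b₂, WeierstrassCurve.b₄]
  · rw [hg3]
    norm_num [WeierstrassCurve.baseChange, WeierstrassCurve.map_c₆, WeierstrassCurve.c₆,
      WeierstrassCurve.b₂, WeierstrassCurve.b₄, WeierstrassCurve.b₆]

/-- **LEVEL 15 COMPLETE — `|c| = 1` for every globally minimal `W/ℚ` and every `X₀(15)`-datum with the lattice clause**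
(the shape `LevelManinOne 15`): pinning `D.f = f₁₅`, (S2)₁₅, and the Néron squeeze with `15a1`.  No modularity, no CDT, no
printed Manin fact, no Cremona table. [cite: AgasheRibetStein2006, §§1–2] [cite: CremonaAlgorithms1997, §2.10] -/
theorem abs_maninConstant_eq_one_fifteen (W : WeierstrassCurve ℚ) [W.IsElliptic] [W.IsGloballyMinimal]
    (D : ModularParametrizationData W 15)
    (hopt : ∀ z ∈ D.L.lattice, ∃ w ∈ periodLattice D.f, z = D.c * w) :
    |D.maninConstant| = 1 := by
  obtain ⟨L₁, hg2, hg3, hle⟩ := periodLatticeLe_fifteen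
  haveI := isElliptic_W15
  haveI := isGloballyMinimal_W15
  refine NeronSqueeze.abs_maninConstant_eq_one_of_periodLattice_le (⟨1, 1, 1, -10, -10⟩ : WeierstrassCurve ℚ)
    L₁ (isNeronLatticeOf_W15 hg2 hg3) W D (fun z hz ↦ hle z ?_) hopt
  rwa [f_eq_cuspFormEta15 D] at hz

/-- **Corollary: no integer `p` with `|p| ≠ 1` — in particular neither `2` nor `3` nor any prime — divides the Manin constant of a
lattice-optimal `X₀(15)`-datum.** [folklore] -/
theorem not_dvd_maninConstant_fifteen (W : WeierstrassCurve ℚ) [W.IsElliptic] [W.IsGloballyMinimal]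
    (D : ModularParametrizationData W 15)
    (hopt : ∀ z ∈ D.L.lattice, ∃ w ∈ periodLattice D.f, z = D.c * w) {p : ℤ} (hp : p.natAbs ≠ 1) :
    ¬ p ∣ D.maninConstant := by
  obtain ⟨L₁, hg2, hg3, hle⟩ := periodLatticeLe_fifteen
  haveI := isElliptic_W15
  haveI := isGloballyMinimal_W15
  refine NeronSqueeze.not_dvd_maninConstant_of_periodLattice_le (⟨1, 1, 1, -10, -10⟩ : WeierstrassCurve ℚ)
    L₁ (isNeronLatticeOf_W15 hg2 hg3) W D (fun z hz ↦ hle z ?_) hopt hp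
  rwa [f_eq_cuspFormEta15 D] at hz

end Summit.BirchSwinnertonDyer.BirchSwinnertonDyer.Theorems.ManinLocalTwoThree.LevelFifteen

end
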